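import Mathlib.Algebra.BigOperators.Ring.Finset
import Mathlib.Algebra.BigOperators.Group.Finset.Sigma
import Mathlib.Algebra.Order.BigOperators.Ring.Finset
import Mathlib.Algebra.Order.Group.Indicator
import Mathlib.Data.Finset.Powerset
import Mathlib.Data.Real.Basic
import Mathlib.Order.UpperLower.Basic
import HarnessLib

/-!
# The van den Berg–Kesten inequality for decision trees (Gladkov 2024, Thm. 4.3)

Source: N. Gladkov, *Percolation Inequalities and
Decision Trees*, arXiv:2408.08457v2 (2024) [Gladkov2024], §2 (Def. 2.3, Def. 2.4, Algorithm 1),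
§4 (Def. 4.1, Def. 4.2, **Theorem 4.3** and its proof, pp. 5–6).

Everything here is proved, in the finitary form in which it is used for Gladkov's three-point
bound (`GladkovThreePointBound.lean`, Thm. 6.2): a finite set `D` of coordinates ("edges"),
configurations `S ⊆ D` (the set of open coordinates) weighted by the Bernoulli weights
`wt D p S = ∏_{i ∈ D} (p if i ∈ S, else 1 - p)`, and probabilities of events of one
configuration (`Pr`) and of an independent pair of configurations (`Pr2`) as finite sums.

* `splice F S₁ S₂` — Gladkov's `C₁ →_F C₂` (Def. 2.3): the configuration equal to `S₁` on `F`
  and to `S₂` off `F`; `swapPair` — the weight-preserving involution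
  `(S₁, S₂) ↦ (S₁ →_F S₂, S₂ →_F S₁)` of the pair space, also for a configuration-dependent,
  self-determined `F` (`sum_pair_reindex`), which is the finitary content of [GZ24, Lemma 4.2]
  (= Gladkov 2024, Lemma 3.1).
* `DTree ι` — binary decision trees querying coordinates of the FIRST configuration and sending
  every queried coordinate to `S` (the sub-class of Def. 2.4 / Algorithm 1 needed in §6; a
  general tree of Def. 2.4 with `S̄`-decisions below the last `S`-decision builds the same set);
  `revealed T S` — the set `S(C₁)` built by `T` on `C₁ = S`; `prune` — removal of one deepest
  node (the surgery `T ↦ T'` of the printed proof); `revealed_congr` — the set built is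
  determined by the configuration on it.
* `dsqWith S A B` — the disjoint occurrence `A □_S B` of Def. 4.2 for a GIVEN set `S`
  (witness `I ⊆ C₁` of `A`, witness `J ⊆ C₁ →_S C₂` of `B`, `I ∩ J ∩ S = ∅`), for increasing
  events presented by their open witnesses; `treeDsq S₀ T A B` — the same with
  `S = S₀ ∪ revealed T C₁`.
* `Pr2_dsqWith_insert_le` — the one-edge splitting step of the printed induction
  (inequality (6), p. 6), proved by the swap-at-`e` involution; `Pr2_treeDsq_le_prune` — the
  induction step `T ↦ T'`; **`Pr2_treeDsq_le` — Theorem 4.3**: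
  `P(A □_S B) ≤ P(A) P(B)` for increasing `A, B` and `S` built by any tree `T`.

Design: configurations are `Finset ι` with `S ⊆ D` enforced by summing over `D.powerset`
(no measure theory; the link with `bondPercolation` is `Russo.measureReal_eq_cylPoly`, made in
`GladkovThreePointBoundProofs.lean`). Increasing events are `IsUpperSet (A : Set (Finset ι))`.
Not here: trees reading both configurations or with `S̄`-decisions at inner nodes (Def. 2.4 in
full), the decision-tree HK inequality (Thm. 3.2), Main Lemma 8.1.
-/

noncomputable section

namespace Literature.Probability.Percolation

namespace DecisionTree

open Finset

variable {ι : Type*} [DecidableEq ι]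

/-! ### Bernoulli weights and finite probabilities -/

/-- The Bernoulli weight of the configuration `S` (open coordinates) among the coordinates `D`:
`∏_{i ∈ D} (p if i ∈ S else 1 - p)`. [cite: Gladkov2024, §2 (Bernoulli bond percolation, product measure)] -/
def wt (D : Finset ι) (p : ℝ) (S : Finset ι) : ℝ := ∏ i ∈ D, if i ∈ S then p else 1 - p

/-- The probability of an event of one configuration: `Σ_{S ⊆ D} wt S · 1[S ∈ X]`.
[cite: Gladkov2024, §2] -/
def Pr (D : Finset ι) (p : ℝ) (X : Set (Finset ι)) : ℝ :=
  ∑ S ∈ D.powerset, X.indicator (wt D p) S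

/-- The weight of a pair of independent configurations. [cite: Gladkov2024, §2] -/
def wt2 (D : Finset ι) (p : ℝ) (x : Finset ι × Finset ι) : ℝ := wt D p x.1 * wt D p x.2

/-- The probability of an event of a pair `(C₁, C₂)` of independent configurations:
`Σ_{S₁, S₂ ⊆ D} wt S₁ wt S₂ · 1[(S₁, S₂) ∈ Y]`. [cite: Gladkov2024, §2] -/
def Pr2 (D : Finset ι) (p : ℝ) (Y : Set (Finset ι × Finset ι)) : ℝ :=
  ∑ x ∈ D.powerset ×ˢ D.powerset, Y.indicator (wt2 D p) x

section Weights

variable (D : Finset ι) {p : ℝ}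

/-- Weights are nonnegative for `p ∈ [0, 1]`. [folklore] -/
theorem wt_nonneg (hp0 : 0 ≤ p) (hp1 : p ≤ 1) (S : Finset ι) : 0 ≤ wt D p S := by
  unfold wt
  refine Finset.prod_nonneg fun i _ => ?_
  split_ifs
  · exact hp0
  · exact sub_nonneg.2 hp1

/-- Pair weights are nonnegative for `p ∈ [0, 1]`. [folklore] -/
theorem wt2_nonneg (hp0 : 0 ≤ p) (hp1 : p ≤ 1) (x : Finset ι × Finset ι) : 0 ≤ wt2 D p x :=
  mul_nonneg (wt_nonneg D hp0 hp1 x.1) (wt_nonneg D hp0 hp1 x.2)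

/-- `Pr` is nonnegative. [folklore] -/
theorem Pr_nonneg (hp0 : 0 ≤ p) (hp1 : p ≤ 1) (X : Set (Finset ι)) : 0 ≤ Pr D p X :=
  Finset.sum_nonneg fun S _ => Set.indicator_nonneg (fun T _ => wt_nonneg D hp0 hp1 T) S

/-- `Pr2` is nonnegative. [folklore] -/
theorem Pr2_nonneg (hp0 : 0 ≤ p) (hp1 : p ≤ 1) (Y : Set (Finset ι × Finset ι)) :
    0 ≤ Pr2 D p Y :=
  Finset.sum_nonneg fun x _ => Set.indicator_nonneg (fun y _ => wt2_nonneg D hp0 hp1 y) x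

/-- `Pr` is monotone (it suffices to compare the events on configurations `⊆ D`). [folklore] -/
theorem Pr_mono (hp0 : 0 ≤ p) (hp1 : p ≤ 1) {X Y : Set (Finset ι)}
    (h : ∀ S, S ⊆ D → S ∈ X → S ∈ Y) : Pr D p X ≤ Pr D p Y := by
  unfold Pr
  refine Finset.sum_le_sum fun S hS => ?_
  rw [Finset.mem_powerset] at hS
  by_cases hX : S ∈ X
  · rw [Set.indicator_of_mem hX, Set.indicator_of_mem (h S hS hX)]
  · rw [Set.indicator_of_notMem hX]
    exact Set.indicator_nonneg (fun T _ => wt_nonneg D hp0 hp1 T) S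

/-- `Pr2` is monotone (it suffices to compare the events on pairs of configurations `⊆ D`).
[folklore] -/
theorem Pr2_mono (hp0 : 0 ≤ p) (hp1 : p ≤ 1) {X Y : Set (Finset ι × Finset ι)}
    (h : ∀ x : Finset ι × Finset ι, x.1 ⊆ D → x.2 ⊆ D → x ∈ X → x ∈ Y) :
    Pr2 D p X ≤ Pr2 D p Y := by
  unfold Pr2
  refine Finset.sum_le_sum fun x hx => ?_
  rw [Finset.mem_product, Finset.mem_powerset, Finset.mem_powerset] at hx
  by_cases hX : x ∈ X
  · rw [Set.indicator_of_mem hX, Set.indicator_of_mem (h x hx.1 hx.2 hX)]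
  · rw [Set.indicator_of_notMem hX]
    exact Set.indicator_nonneg (fun y _ => wt2_nonneg D hp0 hp1 y) x

/-- `Pr2` is additive on disjoint events. [folklore] -/
theorem Pr2_union (p : ℝ) {X Y : Set (Finset ι × Finset ι)} (h : Disjoint X Y) :
    Pr2 D p (X ∪ Y) = Pr2 D p X + Pr2 D p Y := by
  unfold Pr2
  rw [← Finset.sum_add_distrib]
  refine Finset.sum_congr rfl fun x _ => ?_
  rw [Set.indicator_union_of_disjoint h]

/-- `Pr2 X = Pr2 (X ∩ Y) + Pr2 (X \ Y)`. [folklore] -/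
theorem Pr2_eq_inter_add_diff (p : ℝ) (X Y : Set (Finset ι × Finset ι)) :
    Pr2 D p X = Pr2 D p (X ∩ Y) + Pr2 D p (X \ Y) := by
  rw [← Pr2_union D p (Set.disjoint_sdiff_inter.symm), Set.inter_union_sdiff]

/-- `Pr2` is subadditive. [folklore] -/
theorem Pr2_union_le (hp0 : 0 ≤ p) (hp1 : p ≤ 1) (X Y : Set (Finset ι × Finset ι)) :
    Pr2 D p (X ∪ Y) ≤ Pr2 D p X + Pr2 D p Y := by
  rw [Pr2_eq_inter_add_diff D p (X ∪ Y) X]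
  refine add_le_add (Pr2_mono D hp0 hp1 fun x _ _ hx => hx.2)
    (Pr2_mono D hp0 hp1 fun x _ _ hx => ?_)
  rcases hx with ⟨hx | hx, hx'⟩
  · exact absurd hx hx'
  · exact hx

/-- `Pr2 (X × Y) = Pr X · Pr Y` (independence of the two configurations). [folklore] -/
theorem Pr2_prod (p : ℝ) (X Y : Set (Finset ι)) :
    Pr2 D p (X ×ˢ Y) = Pr D p X * Pr D p Y := by
  unfold Pr2 Pr
  rw [Finset.sum_product, Finset.sum_mul_sum]
  refine Finset.sum_congr rfl fun S _ => Finset.sum_congr rfl fun T _ => ?_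
  by_cases hS : S ∈ X
  · by_cases hT : T ∈ Y
    · rw [Set.indicator_of_mem (Set.mk_mem_prod hS hT), Set.indicator_of_mem hS,
        Set.indicator_of_mem hT]
      rfl
    · rw [Set.indicator_of_notMem (fun h : (S, T) ∈ X ×ˢ Y => hT h.2),
        Set.indicator_of_notMem hT, mul_zero]
  · rw [Set.indicator_of_notMem (fun h : (S, T) ∈ X ×ˢ Y => hS h.1),
      Set.indicator_of_notMem hS, zero_mul]

/-- `Pr` is additive on disjoint events. [folklore] -/
theorem Pr_union (p : ℝ) {X Y : Set (Finset ι)} (h : Disjoint X Y) :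
    Pr D p (X ∪ Y) = Pr D p X + Pr D p Y := by
  unfold Pr
  rw [← Finset.sum_add_distrib]
  refine Finset.sum_congr rfl fun x _ => ?_
  rw [Set.indicator_union_of_disjoint h]

/-- `Pr` is subadditive. [folklore] -/
theorem Pr_union_le (hp0 : 0 ≤ p) (hp1 : p ≤ 1) (X Y : Set (Finset ι)) :
    Pr D p (X ∪ Y) ≤ Pr D p X + Pr D p Y := by
  have h1 : Pr D p (X ∪ Y) = Pr D p ((X ∪ Y) ∩ X) + Pr D p ((X ∪ Y) \ X) := by
    rw [← Pr_union D p (Set.disjoint_sdiff_inter.symm), Set.inter_union_sdiff]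
  rw [h1]
  refine add_le_add (Pr_mono D hp0 hp1 fun x _ hx => hx.2) (Pr_mono D hp0 hp1 fun x _ hx => ?_)
  rcases hx with ⟨hx | hx, hx'⟩
  · exact absurd hx hx'
  · exact hx

/-- The weight of `S ⊆ D` is `p^{#S} (1-p)^{#(D ∖ S)}`. [folklore] -/
theorem wt_eq_pow (p : ℝ) {S : Finset ι} (hS : S ⊆ D) :
    wt D p S = p ^ S.card * (1 - p) ^ (D.card - S.card) := by
  unfold wt
  rw [Finset.prod_ite, Finset.prod_const, Finset.prod_const, Finset.filter_mem_eq_inter,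
    Finset.inter_eq_right.2 hS, Finset.filter_notMem_eq_sdiff, Finset.card_sdiff_of_subset hS]

/-- **Total mass one**: `Σ_{S ⊆ D} wt S = 1`. [folklore] -/
theorem Pr_univ (p : ℝ) : Pr D p Set.univ = 1 := by
  unfold Pr
  simp only [Set.indicator_univ]
  rw [Finset.sum_congr rfl fun S hS => wt_eq_pow D p (Finset.mem_powerset.1 hS),
    Finset.sum_pow_mul_eq_add_pow]
  simp

/-- The total mass of the configurations `⊆ D`. [folklore] -/
theorem sum_wt (p : ℝ) : ∑ S ∈ D.powerset, wt D p S = 1 := by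
  have := Pr_univ D p
  unfold Pr at this
  simpa only [Set.indicator_univ] using this

end Weights

/-! ### Splicing two configurations (`C₁ →_F C₂`) -/

/-- `splice F S₁ S₂ = (S₁ ∩ F) ∪ (S₂ \ F)`: the configuration `C₁ →_F C₂` that coincides with
`S₁` on `F` and with `S₂` off `F`. [cite: Gladkov2024, Def. 2.3] -/
def splice (F S₁ S₂ : Finset ι) : Finset ι := (S₁ ∩ F) ∪ (S₂ \ F)

/-- Membership in a splice. [cite: Gladkov2024, Def. 2.3] -/
theorem mem_splice {F S₁ S₂ : Finset ι} {i : ι} :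
    i ∈ splice F S₁ S₂ ↔ (i ∈ F ∧ i ∈ S₁) ∨ (i ∉ F ∧ i ∈ S₂) := by
  simp only [splice, Finset.mem_union, Finset.mem_inter, Finset.mem_sdiff]
  tauto

/-- On `F` the splice is the first configuration. [cite: Gladkov2024, Def. 2.3] -/
theorem mem_splice_of_mem {F S₁ S₂ : Finset ι} {i : ι} (hi : i ∈ F) :
    i ∈ splice F S₁ S₂ ↔ i ∈ S₁ := by
  rw [mem_splice]; tauto

/-- Off `F` the splice is the second configuration. [cite: Gladkov2024, Def. 2.3] -/
theorem mem_splice_of_not_mem {F S₁ S₂ : Finset ι} {i : ι} (hi : i ∉ F) :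
    i ∈ splice F S₁ S₂ ↔ i ∈ S₂ := by
  rw [mem_splice]; tauto

/-- A splice of configurations `⊆ D` is `⊆ D`. [folklore] -/
theorem splice_subset {D F S₁ S₂ : Finset ι} (h₁ : S₁ ⊆ D) (h₂ : S₂ ⊆ D) :
    splice F S₁ S₂ ⊆ D := by
  intro i hi
  rcases mem_splice.1 hi with ⟨-, h⟩ | ⟨-, h⟩
  · exact h₁ h
  · exact h₂ h

/-- Splicing back: `(S₁ →_F S₂) →_F (S₂ →_F S₁) = S₁`. [folklore] -/
theorem splice_splice_left (F S₁ S₂ : Finset ι) :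
    splice F (splice F S₁ S₂) (splice F S₂ S₁) = S₁ := by
  ext i
  by_cases hi : i ∈ F
  · rw [mem_splice_of_mem hi, mem_splice_of_mem hi]
  · rw [mem_splice_of_not_mem hi, mem_splice_of_not_mem hi]

/-- The splice agrees with the first configuration on `F`. [folklore] -/
theorem splice_agree (F S₁ S₂ : Finset ι) : ∀ i ∈ F, (i ∈ splice F S₁ S₂ ↔ i ∈ S₁) :=
  fun _ hi => mem_splice_of_mem hi

/-- `S →_F S = S`. [folklore] -/
theorem splice_self (F S : Finset ι) : splice F S S = S := by
  ext i
  by_cases hi : i ∈ F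
  · rw [mem_splice_of_mem hi]
  · rw [mem_splice_of_not_mem hi]

/-- If `S₁'` agrees with `S₁` on `F`, splicing gives the same result. [folklore] -/
theorem splice_congr_left {F S₁ S₁' : Finset ι} (h : ∀ i ∈ F, (i ∈ S₁ ↔ i ∈ S₁')) (S₂ : Finset ι) :
    splice F S₁ S₂ = splice F S₁' S₂ := by
  ext i
  by_cases hi : i ∈ F
  · rw [mem_splice_of_mem hi, mem_splice_of_mem hi, h i hi]
  · rw [mem_splice_of_not_mem hi, mem_splice_of_not_mem hi]

/-- **Weight preservation of the swap** `(S₁, S₂) ↦ (S₁ →_F S₂, S₂ →_F S₁)`: the product of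
the weights is unchanged (each coordinate's two values are merely exchanged).
[cite: Gladkov2024, Lemma 3.1 (= GZ24 Lemma 4.2)] -/
theorem wt_splice_mul_wt_splice (D : Finset ι) (p : ℝ) (F S₁ S₂ : Finset ι) :
    wt D p (splice F S₁ S₂) * wt D p (splice F S₂ S₁) = wt D p S₁ * wt D p S₂ := by
  unfold wt
  rw [← Finset.prod_mul_distrib, ← Finset.prod_mul_distrib]
  refine Finset.prod_congr rfl fun i _ => ?_
  by_cases hi : i ∈ F
  · simp only [mem_splice_of_mem hi]
  · simp only [mem_splice_of_not_mem hi]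
    ring

/-! ### The swap involution of the pair space -/

/-- A set-valued map on configurations is *self-determined* if its value is determined by the
configuration restricted to that value (the defining property of a set built by a decision
tree reading `C₁`). [cite: Gladkov2024, Def. 2.4] -/
def SelfDetermined (Fm : Finset ι → Finset ι) : Prop :=
  ∀ S S' : Finset ι, (∀ i ∈ Fm S, (i ∈ S ↔ i ∈ S')) → Fm S' = Fm S

/-- The swap of the pair space along a (configuration-dependent) set `Fm C₁`:
`(C₁, C₂) ↦ (C₁ →_F C₂, C₂ →_F C₁)`. [cite: Gladkov2024, Lemma 3.1] -/
def swapPair (Fm : Finset ι → Finset ι) (x : Finset ι × Finset ι) : Finset ι × Finset ι :=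
  (splice (Fm x.1) x.1 x.2, splice (Fm x.1) x.2 x.1)

/-- The first component of the swap agrees with `C₁` on `Fm C₁`, so builds the same set.
[cite: Gladkov2024, Lemma 3.1] -/
theorem apply_swapPair_fst {Fm : Finset ι → Finset ι} (hF : SelfDetermined Fm)
    (x : Finset ι × Finset ι) : Fm (swapPair Fm x).1 = Fm x.1 :=
  hF x.1 _ fun _ hi => (mem_splice_of_mem hi).symm

/-- The swap is an involution. [cite: Gladkov2024, Lemma 3.1] -/
theorem swapPair_swapPair {Fm : Finset ι → Finset ι} (hF : SelfDetermined Fm)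
    (x : Finset ι × Finset ι) : swapPair Fm (swapPair Fm x) = x := by
  have h1 := apply_swapPair_fst hF x
  unfold swapPair at h1 ⊢
  simp only at h1 ⊢
  rw [h1, splice_splice_left, splice_splice_left]

/-- The swap preserves the pair space of configurations `⊆ D`. [folklore] -/
theorem swapPair_mem {D : Finset ι} (Fm : Finset ι → Finset ι) {x : Finset ι × Finset ι}
    (hx : x ∈ D.powerset ×ˢ D.powerset) : swapPair Fm x ∈ D.powerset ×ˢ D.powerset := by
  rw [Finset.mem_product, Finset.mem_powerset, Finset.mem_powerset] at hx ⊢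
  exact ⟨splice_subset hx.1 hx.2, splice_subset hx.2 hx.1⟩

/-- The swap preserves pair weights. [cite: Gladkov2024, Lemma 3.1] -/
theorem wt2_swapPair (D : Finset ι) (p : ℝ) (Fm : Finset ι → Finset ι)
    (x : Finset ι × Finset ι) : wt2 D p (swapPair Fm x) = wt2 D p x := by
  unfold wt2 swapPair
  exact wt_splice_mul_wt_splice D p (Fm x.1) x.1 x.2

/-- **Reindexing by the swap** (finitary form of Gladkov's Lemma 3.1 / [GZ24, Lemma 4.2]: the
pair `(C₁ →_S C₂, C₂ →_S C₁)` is again an independent pair): for self-determined `Fm`,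
`Σ_x wt2 x · f x = Σ_x wt2 x · f (swap x)`. [cite: Gladkov2024, Lemma 3.1] -/
theorem sum_pair_reindex (D : Finset ι) (p : ℝ) {Fm : Finset ι → Finset ι}
    (hF : SelfDetermined Fm) (f : Finset ι × Finset ι → ℝ) :
    ∑ x ∈ D.powerset ×ˢ D.powerset, wt2 D p x * f x =
      ∑ x ∈ D.powerset ×ˢ D.powerset, wt2 D p x * f (swapPair Fm x) := by
  refine Finset.sum_nbij' (swapPair Fm) (swapPair Fm) (fun x hx => swapPair_mem Fm hx)
    (fun x hx => swapPair_mem Fm hx) (fun x _ => swapPair_swapPair hF x)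
    (fun x _ => swapPair_swapPair hF x) fun x _ => ?_
  rw [wt2_swapPair, swapPair_swapPair hF]

/-- `Pr2` is invariant under the swap: `Pr2 (swap ⁻¹' Y) = Pr2 Y`. [cite: Gladkov2024, Lemma 3.1] -/
theorem Pr2_preimage_swapPair (D : Finset ι) (p : ℝ) {Fm : Finset ι → Finset ι}
    (hF : SelfDetermined Fm) (Y : Set (Finset ι × Finset ι)) :
    Pr2 D p (swapPair Fm ⁻¹' Y) = Pr2 D p Y := by
  unfold Pr2
  have h := sum_pair_reindex D p hF (Y.indicator fun _ => (1 : ℝ))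
  have key : ∀ (Z : Set (Finset ι × Finset ι)) (x : Finset ι × Finset ι),
      Z.indicator (wt2 D p) x = wt2 D p x * Z.indicator (fun _ => (1 : ℝ)) x := by
    intro Z x
    by_cases hx : x ∈ Z <;> simp [hx]
  simp_rw [key]
  rw [h]
  refine Finset.sum_congr rfl fun x _ => ?_
  by_cases hx : swapPair Fm x ∈ Y
  · rw [Set.indicator_of_mem hx, Set.indicator_of_mem (show x ∈ swapPair Fm ⁻¹' Y from hx)]
  · rw [Set.indicator_of_notMem hx,
      Set.indicator_of_notMem (show x ∉ swapPair Fm ⁻¹' Y from hx)]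

/-! ### The Cauchy–Schwarz step (Theorem 5.2 for a tree that reveals everything it queries) -/

section CauchySchwarz

open Classical in
/-- The `0/1`-indicator of an event, as a real number. [folklore] -/
def ind {α : Type*} (X : Set α) (x : α) : ℝ := if x ∈ X then 1 else 0

omit [DecidableEq ι] in
/-- `ind` of a member. [folklore] -/
theorem ind_of_mem {α : Type*} {X : Set α} {x : α} (h : x ∈ X) : ind X x = 1 := by
  unfold ind; rw [if_pos h]

omit [DecidableEq ι] in
/-- `ind` of a non-member. [folklore] -/
theorem ind_of_not_mem {α : Type*} {X : Set α} {x : α} (h : x ∉ X) : ind X x = 0 := by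
  unfold ind; rw [if_neg h]

omit [DecidableEq ι] in
/-- `ind X x ^ 2 = ind X x`. [folklore] -/
theorem ind_sq {α : Type*} (X : Set α) (x : α) : ind X x ^ 2 = ind X x := by
  by_cases h : x ∈ X
  · rw [ind_of_mem h]; norm_num
  · rw [ind_of_not_mem h]; norm_num

omit [DecidableEq ι] in
/-- `0 ≤ ind X x`. [folklore] -/
theorem ind_nonneg {α : Type*} (X : Set α) (x : α) : 0 ≤ ind X x := by
  by_cases h : x ∈ X
  · rw [ind_of_mem h]; exact zero_le_one
  · rw [ind_of_not_mem h]

omit [DecidableEq ι] in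
/-- For `B ⊆ A`, `ind A x * ind B x = ind B x`. [folklore] -/
theorem ind_mul_ind_of_subset {α : Type*} {A B : Set α} (h : B ⊆ A) (x : α) :
    ind A x * ind B x = ind B x := by
  by_cases hB : x ∈ B
  · rw [ind_of_mem hB, ind_of_mem (h hB), one_mul]
  · rw [ind_of_not_mem hB, mul_zero]

omit [DecidableEq ι] in
/-- The indicator of a weight is the weight times `ind`. [folklore] -/
theorem indicator_eq_mul_ind {α : Type*} (X : Set α) (f : α → ℝ) (x : α) :
    X.indicator f x = f x * ind X x := by
  by_cases h : x ∈ X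
  · rw [Set.indicator_of_mem h, ind_of_mem h, mul_one]
  · rw [Set.indicator_of_notMem h, ind_of_not_mem h, mul_zero]

/-- `Pr` as a weighted sum of `ind`. [folklore] -/
theorem Pr_eq_sum_ind (D : Finset ι) (p : ℝ) (X : Set (Finset ι)) :
    Pr D p X = ∑ S ∈ D.powerset, wt D p S * ind X S := by
  unfold Pr
  exact Finset.sum_congr rfl fun S _ => indicator_eq_mul_ind X _ S

/-- `Pr2` as a weighted sum of `ind`. [folklore] -/
theorem Pr2_eq_sum_ind (D : Finset ι) (p : ℝ) (Y : Set (Finset ι × Finset ι)) :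
    Pr2 D p Y = ∑ x ∈ D.powerset ×ˢ D.powerset, wt2 D p x * ind Y x := by
  unfold Pr2
  exact Finset.sum_congr rfl fun x _ => indicator_eq_mul_ind Y _ x

/-- An event of one configuration is *determined on `Fm`* if membership of `K` only depends on
`K` restricted to `Fm K` (e.g. an event decided by the tree building `Fm`). [cite: Gladkov2024, Def. 5.1 (T decides A)] -/
def LocalOn (Fm : Finset ι → Finset ι) (A : Set (Finset ι)) : Prop :=
  ∀ K K' : Finset ι, (∀ i ∈ Fm K, (i ∈ K ↔ i ∈ K')) → K ∈ A → K' ∈ A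

/-- The conditional probability of `B` given the revealed coordinates, times nothing: the inner
sum `h(K) = Σ_{K₂} wt K₂ · 1[K →_{Fm K} K₂ ∈ B]`. [cite: Gladkov2024, proof of Thm. 5.2 ((9), P(B | T₂ goes through N))] -/
def condSum (D : Finset ι) (p : ℝ) (Fm : Finset ι → Finset ι) (B : Set (Finset ι))
    (K : Finset ι) : ℝ :=
  ∑ K₂ ∈ D.powerset, wt D p K₂ * ind B (splice (Fm K) K K₂)

/-- `condSum` only depends on the configuration through `Fm K`. [cite: Gladkov2024, proof of Thm. 5.2] -/
theorem condSum_congr (D : Finset ι) (p : ℝ) {Fm : Finset ι → Finset ι} (hF : SelfDetermined Fm)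
    (B : Set (Finset ι)) {K K' : Finset ι} (h : ∀ i ∈ Fm K, (i ∈ K ↔ i ∈ K')) :
    condSum D p Fm B K' = condSum D p Fm B K := by
  unfold condSum
  rw [hF K K' h]
  refine Finset.sum_congr rfl fun K₂ _ => ?_
  rw [splice_congr_left h K₂]

/-- `0 ≤ condSum`. [folklore] -/
theorem condSum_nonneg (D : Finset ι) {p : ℝ} (hp0 : 0 ≤ p) (hp1 : p ≤ 1)
    (Fm : Finset ι → Finset ι) (B : Set (Finset ι)) (K : Finset ι) : 0 ≤ condSum D p Fm B K :=
  Finset.sum_nonneg fun K₂ _ => mul_nonneg (wt_nonneg D hp0 hp1 K₂) (ind_nonneg B _)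

/-- The event `E = {(C₁, C₂) | C₁ ∈ B, C₁ →_S C₂ ∈ B}` whose probability Theorem 5.2 bounds
from below. [cite: Gladkov2024, Thm. 5.2] -/
def bothIn (Fm : Finset ι → Finset ι) (B : Set (Finset ι)) : Set (Finset ι × Finset ι) :=
  {x | x.1 ∈ B ∧ splice (Fm x.1) x.1 x.2 ∈ B}

/-- `Pr2 (bothIn Fm B) = Σ_K wt K · 1_B(K) · condSum K`. [cite: Gladkov2024, proof of Thm. 5.2] -/
theorem Pr2_bothIn_eq (D : Finset ι) (p : ℝ) (Fm : Finset ι → Finset ι) (B : Set (Finset ι)) :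
    Pr2 D p (bothIn Fm B) = ∑ K ∈ D.powerset, wt D p K * ind B K * condSum D p Fm B K := by
  rw [Pr2_eq_sum_ind, Finset.sum_product]
  refine Finset.sum_congr rfl fun K _ => ?_
  unfold condSum
  rw [Finset.mul_sum]
  refine Finset.sum_congr rfl fun K₂ _ => ?_
  have : ind (bothIn Fm B) (K, K₂) = ind B K * ind B (splice (Fm K) K K₂) := by
    by_cases h1 : K ∈ B
    · by_cases h2 : splice (Fm K) K K₂ ∈ B
      · rw [ind_of_mem h1, ind_of_mem h2, ind_of_mem (show (K, K₂) ∈ bothIn Fm B from ⟨h1, h2⟩)]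
        norm_num
      · rw [ind_of_mem h1, ind_of_not_mem h2,
          ind_of_not_mem (show (K, K₂) ∉ bothIn Fm B from fun h => h2 h.2)]
        norm_num
    · rw [ind_of_not_mem h1, ind_of_not_mem (show (K, K₂) ∉ bothIn Fm B from fun h => h1 h.1)]
      norm_num
  rw [this, wt2]
  ring

/-- **(9) summed with Lemma 3.1**: `Σ_K wt K · 1_A(K) · condSum K = Pr B` for `B ⊆ A`, `A`
determined on `Fm` (the law of `C₁ →_S C₂` is that of `C₁`). [cite: Gladkov2024, proof of Thm. 5.2 ((8)–(9))] -/
theorem sum_ind_mul_condSum (D : Finset ι) (p : ℝ) {Fm : Finset ι → Finset ι}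
    (hF : SelfDetermined Fm) {A B : Set (Finset ι)} (hA : LocalOn Fm A) (hBA : B ⊆ A) :
    ∑ K ∈ D.powerset, wt D p K * ind A K * condSum D p Fm B K = Pr D p B := by
  have hAiff : ∀ x : Finset ι × Finset ι, ind A x.1 = ind A (splice (Fm x.1) x.1 x.2) := by
    intro x
    have h1 : x.1 ∈ A ↔ splice (Fm x.1) x.1 x.2 ∈ A :=
      ⟨fun h => hA _ _ (fun i hi => (mem_splice_of_mem hi).symm) h,
        fun h => hA _ _ (fun i hi => by
          rw [hF x.1 _ (fun j hj => (mem_splice_of_mem hj).symm)] at hi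
          exact mem_splice_of_mem hi) h⟩
    by_cases h : x.1 ∈ A
    · rw [ind_of_mem h, ind_of_mem (h1.1 h)]
    · rw [ind_of_not_mem h, ind_of_not_mem (fun h' => h (h1.2 h'))]
  calc ∑ K ∈ D.powerset, wt D p K * ind A K * condSum D p Fm B K
      = ∑ x ∈ D.powerset ×ˢ D.powerset,
          wt2 D p x * (ind A (swapPair Fm x).1 * ind B (swapPair Fm x).1) := by
        rw [Finset.sum_product]
        refine Finset.sum_congr rfl fun K _ => ?_
        unfold condSum
        rw [Finset.mul_sum]
        refine Finset.sum_congr rfl fun K₂ _ => ?_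
        rw [hAiff (K, K₂)]
        simp only [swapPair, wt2]
        ring
    _ = ∑ x ∈ D.powerset ×ˢ D.powerset, wt2 D p x * (ind A x.1 * ind B x.1) :=
        (sum_pair_reindex D p hF fun y => ind A y.1 * ind B y.1).symm
    _ = ∑ x ∈ D.powerset ×ˢ D.powerset, wt D p x.1 * ind B x.1 * wt D p x.2 := by
        refine Finset.sum_congr rfl fun x _ => ?_
        rw [ind_mul_ind_of_subset hBA, wt2]
        ring
    _ = Pr D p B := by
        rw [Finset.sum_product, Pr_eq_sum_ind]
        refine Finset.sum_congr rfl fun K _ => ?_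
        dsimp only
        rw [← Finset.mul_sum, sum_wt, mul_one]

/-- **(10) summed with Lemma 3.1**: `Pr2 (bothIn Fm B) = Σ_K wt K · 1_A(K) · condSum K ^ 2`
(conditionally on the revealed coordinates, `C₁` and `C₁ →_S C₂` are independent with the same
law). [cite: Gladkov2024, proof of Thm. 5.2 ((10))] -/
theorem Pr2_bothIn_eq_sum_sq (D : Finset ι) (p : ℝ) {Fm : Finset ι → Finset ι}
    (hF : SelfDetermined Fm) {A B : Set (Finset ι)} (hA : LocalOn Fm A) (hBA : B ⊆ A) :
    Pr2 D p (bothIn Fm B) = ∑ K ∈ D.powerset, wt D p K * ind A K * condSum D p Fm B K ^ 2 := by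
  have hagree : ∀ x : Finset ι × Finset ι, ∀ i ∈ Fm x.1, (i ∈ x.1 ↔ i ∈ (swapPair Fm x).1) :=
    fun x i hi => (mem_splice_of_mem hi).symm
  have hAiff : ∀ x : Finset ι × Finset ι, ind A x.1 = ind A (swapPair Fm x).1 := by
    intro x
    have h1 : x.1 ∈ A ↔ (swapPair Fm x).1 ∈ A :=
      ⟨fun h => hA _ _ (hagree x) h, fun h => hA _ _ (fun i hi => by
          rw [apply_swapPair_fst hF] at hi
          exact ((hagree x) i hi).symm) h⟩
    by_cases h : x.1 ∈ A
    · rw [ind_of_mem h, ind_of_mem (h1.1 h)]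
    · rw [ind_of_not_mem h, ind_of_not_mem (fun h' => h (h1.2 h'))]
  have hcond : ∀ x : Finset ι × Finset ι,
      condSum D p Fm B x.1 = condSum D p Fm B (swapPair Fm x).1 :=
    fun x => (condSum_congr D p hF B (hagree x)).symm
  symm
  calc ∑ K ∈ D.powerset, wt D p K * ind A K * condSum D p Fm B K ^ 2
      = ∑ x ∈ D.powerset ×ˢ D.powerset, wt2 D p x *
          (ind A (swapPair Fm x).1 * condSum D p Fm B (swapPair Fm x).1 *
            ind B (swapPair Fm x).1) := by
        rw [Finset.sum_product]
        refine Finset.sum_congr rfl fun K _ => ?_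
        have hK : wt D p K * ind A K * condSum D p Fm B K ^ 2 = ∑ K₂ ∈ D.powerset,
            wt D p K * ind A K * condSum D p Fm B K * (wt D p K₂ * ind B (splice (Fm K) K K₂)) := by
          rw [← Finset.mul_sum]; unfold condSum; ring
        rw [hK]
        refine Finset.sum_congr rfl fun K₂ _ => ?_
        rw [hAiff (K, K₂), hcond (K, K₂)]
        simp only [swapPair, wt2]
        ring
    _ = ∑ x ∈ D.powerset ×ˢ D.powerset, wt2 D p x *
          (ind A x.1 * condSum D p Fm B x.1 * ind B x.1) :=
        (sum_pair_reindex D p hF fun y => ind A y.1 * condSum D p Fm B y.1 * ind B y.1).symm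
    _ = ∑ x ∈ D.powerset ×ˢ D.powerset,
          wt D p x.1 * ind B x.1 * condSum D p Fm B x.1 * wt D p x.2 := by
        refine Finset.sum_congr rfl fun x _ => ?_
        rw [wt2, mul_comm (ind A x.1), mul_assoc (condSum D p Fm B x.1),
          ind_mul_ind_of_subset hBA]
        ring
    _ = Pr2 D p (bothIn Fm B) := by
        rw [Finset.sum_product, Pr2_bothIn_eq]
        refine Finset.sum_congr rfl fun K _ => ?_
        dsimp only
        rw [← Finset.mul_sum, sum_wt, mul_one]

/-- **Gladkov 2024, Theorem 5.2 (Cauchy–Schwarz step), for a tree revealing everything it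
queries** (`T₁` builds `Fm`, `T₂` reveals the rest into `S̄`): for `B ⊆ A` with `A` decided by
the tree, `P(B)² ≤ P(A) · P(C₁ ∈ B, C₁ →_S C₂ ∈ B)`, i.e. (7) `P(C₁ ∈ B, C₁ →_S C₂ ∈ B) ≥ P(B)²/P(A)`.
[cite: Gladkov2024, Thm. 5.2 and Cor. 5.3] -/
theorem sq_Pr_le_Pr_mul_Pr2_bothIn (D : Finset ι) {p : ℝ} (hp0 : 0 ≤ p) (hp1 : p ≤ 1)
    {Fm : Finset ι → Finset ι} (hF : SelfDetermined Fm) {A B : Set (Finset ι)}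
    (hA : LocalOn Fm A) (hBA : B ⊆ A) :
    Pr D p B ^ 2 ≤ Pr D p A * Pr2 D p (bothIn Fm B) := by
  rw [← sum_ind_mul_condSum D p hF hA hBA, Pr2_bothIn_eq_sum_sq D p hF hA hBA, Pr_eq_sum_ind]
  refine Finset.sum_sq_le_sum_mul_sum_of_sq_le_mul _ (fun K _ => ?_) (fun K _ => ?_) (fun K _ => ?_)
  · exact mul_nonneg (wt_nonneg D hp0 hp1 K) (ind_nonneg A K)
  · exact mul_nonneg (mul_nonneg (wt_nonneg D hp0 hp1 K) (ind_nonneg A K)) (sq_nonneg _)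
  · exact le_of_eq (by ring)

end CauchySchwarz

/-! ### Decision trees reading the first configuration -/

/-- Binary decision trees over the coordinates `ι`: a `leaf` stops; `node e yes no` queries the
coordinate `e` of the first configuration, sends it to `S`, and continues with `yes` if `e` is
open and with `no` otherwise. [cite: Gladkov2024, Def. 2.4 and Algorithm 1] -/
inductive _root_.Literature.Probability.Percolation.DTree (ι : Type*) : Type _
  | leaf : DTree ι
  | node : ι → DTree ι → DTree ι → DTree ι

/-- The set `S(C₁)` built by the tree on the configuration `C₁ = S`: the coordinates queried
along the path followed by `S`. [cite: Gladkov2024, Def. 2.4 and Algorithm 1] -/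
def revealed : DTree ι → Finset ι → Finset ι
  | .leaf, _ => ∅
  | .node e yes no, S => if e ∈ S then insert e (revealed yes S) else insert e (revealed no S)

/-- The number of (decision) nodes of a tree. [folklore] -/
def size : DTree ι → ℕ
  | .leaf => 0
  | .node _ yes no => size yes + size no + 1

/-- Removing one deepest node (a node both of whose children are leaves): the surgery
`T ↦ T'` of the printed proof, which stops querying one coordinate. [cite: Gladkov2024, proof of Thm. 4.3 (and of Thm. 3.2)] -/
def prune : DTree ι → DTree ι
  | .leaf => .leaf
  | .node e yes no =>
      if size yes = 0 then (if size no = 0 then .leaf else .node e yes (prune no))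
      else .node e (prune yes) no

omit [DecidableEq ι] in
/-- A tree of size `0` is a leaf. [folklore] -/
theorem eq_leaf_of_size_eq_zero {T : DTree ι} (h : size T = 0) : T = .leaf := by
  cases T with
  | leaf => rfl
  | node e yes no => simp [size] at h

omit [DecidableEq ι] in
/-- Pruning removes exactly one node. [folklore] -/
theorem size_prune : ∀ T : DTree ι, size T ≠ 0 → size (prune T) + 1 = size T
  | .leaf, h => absurd rfl h
  | .node e yes no, _ => by
      simp only [prune]
      by_cases hy : size yes = 0
      · by_cases hn : size no = 0
        · simp [hy, hn, size]
        · simp only [hy, hn, if_true, if_false, size]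
          have := size_prune no hn
          omega
      · simp only [hy, if_false, size]
        have := size_prune yes hy
        omega

/-- **The set built by a tree is determined by the configuration on it** (determinism of the
exploration): if `S'` agrees with `S` on `revealed T S` then `T` builds the same set on `S'`.
[cite: Gladkov2024, Def. 2.4] -/
theorem revealed_congr : ∀ (T : DTree ι) {S S' : Finset ι},
    (∀ i ∈ revealed T S, (i ∈ S ↔ i ∈ S')) → revealed T S' = revealed T S
  | .leaf, _, _, _ => rfl
  | .node e yes no, S, S', h => by
      have he : e ∈ revealed (.node e yes no) S := by
        unfold revealed; split_ifs <;> exact Finset.mem_insert_self _ _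
      have hee := h e he
      by_cases hS : e ∈ S
      · have hS' : e ∈ S' := hee.1 hS
        have hsub : ∀ i ∈ revealed yes S, (i ∈ S ↔ i ∈ S') := fun i hi =>
          h i (by unfold revealed; rw [if_pos hS]; exact Finset.mem_insert_of_mem hi)
        show (if e ∈ S' then _ else _) = (if e ∈ S then _ else _)
        rw [if_pos hS', if_pos hS, revealed_congr yes hsub]
      · have hS' : e ∉ S' := fun h' => hS (hee.2 h')
        have hsub : ∀ i ∈ revealed no S, (i ∈ S ↔ i ∈ S') := fun i hi =>
          h i (by unfold revealed; rw [if_neg hS]; exact Finset.mem_insert_of_mem hi)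
        show (if e ∈ S' then _ else _) = (if e ∈ S then _ else _)
        rw [if_neg hS', if_neg hS, revealed_congr no hsub]

/-- `revealed T` is self-determined. [cite: Gladkov2024, Def. 2.4] -/
theorem selfDetermined_revealed (T : DTree ι) : SelfDetermined (revealed T) :=
  fun _ _ h => revealed_congr T h

/-- `S₀ ∪ revealed T ·` is self-determined for any fixed `S₀`. [folklore] -/
theorem selfDetermined_union_revealed (S₀ : Finset ι) (T : DTree ι) :
    SelfDetermined fun S => S₀ ∪ revealed T S := fun S S' h => by
  simp only
  rw [revealed_congr T fun i hi => h i (Finset.mem_union_right _ hi)]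

omit [DecidableEq ι] in
/-- A constant set is self-determined. [folklore] -/
theorem selfDetermined_const (F : Finset ι) : SelfDetermined fun _ : Finset ι => F :=
  fun _ _ _ => rfl

/-! ### Disjoint occurrence along a set `S` -/

/-- **Disjoint occurrence `A □_S B` for a given set `S`** (Def. 4.2, for increasing events
presented by open witnesses): there are `I ⊆ C₁` with `I ∈ A` and `J ⊆ C₁ →_S C₂` with `J ∈ B`
such that `I ∩ J ∩ S = ∅` (the witnesses are disjoint on `S`; off `S` the two configurations are
independent and the witnesses may overlap). [cite: Gladkov2024, Def. 4.2] -/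
def dsqWith (S : Finset ι) (A B : Set (Finset ι)) : Set (Finset ι × Finset ι) :=
  {x | ∃ I J : Finset ι, I ⊆ x.1 ∧ I ∈ A ∧ J ⊆ splice S x.1 x.2 ∧ J ∈ B ∧
    ∀ i ∈ I, i ∈ J → i ∉ S}

/-- `A □_S B` with `S = S₀ ∪ S(C₁)`, `S(C₁)` built by the tree `T`. [cite: Gladkov2024, Def. 4.2] -/
def treeDsq (S₀ : Finset ι) (T : DTree ι) (A B : Set (Finset ι)) : Set (Finset ι × Finset ι) :=
  {x | x ∈ dsqWith (S₀ ∪ revealed T x.1) A B}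

/-- For `S = ∅`, `A □_∅ B ⊆ A × B` when `A, B` are increasing (in fact equality).
[cite: Gladkov2024, §4 (remark before Thm. 4.3)] -/
theorem dsqWith_empty_subset {A B : Set (Finset ι)} (hA : IsUpperSet A) (hB : IsUpperSet B) :
    dsqWith ∅ A B ⊆ A ×ˢ B := by
  rintro x ⟨I, J, hI, hIA, hJ, hJB, -⟩
  refine ⟨hA hI hIA, hB (fun i hi => ?_) hJB⟩
  have := hJ hi
  rwa [mem_splice_of_not_mem (Finset.notMem_empty i)] at this

/-- An event of the pair space is *determined by `C₁` on `S₀`* if membership only depends on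
the first configuration restricted to `S₀`. [folklore] -/
def FstLocal (S₀ : Finset ι) (Z : Set (Finset ι × Finset ι)) : Prop :=
  ∀ x y : Finset ι × Finset ι, (∀ i ∈ S₀, (i ∈ x.1 ↔ i ∈ y.1)) → x ∈ Z → y ∈ Z

omit [DecidableEq ι] in
/-- `univ` is determined by nothing. [folklore] -/
theorem fstLocal_univ (S₀ : Finset ι) : FstLocal S₀ (Set.univ : Set (Finset ι × Finset ι)) :=
  fun _ _ _ _ => Set.mem_univ _

/-- Intersecting with the query `e ∈ C₁` keeps locality on `insert e S₀`. [folklore] -/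
theorem FstLocal.inter_mem {S₀ : Finset ι} {Z : Set (Finset ι × Finset ι)} (hZ : FstLocal S₀ Z)
    (e : ι) : FstLocal (insert e S₀) (Z ∩ {x | e ∈ x.1}) := fun x y h hx =>
  ⟨hZ x y (fun i hi => h i (Finset.mem_insert_of_mem hi)) hx.1,
    (h e (Finset.mem_insert_self e S₀)).1 hx.2⟩

/-- Intersecting with the query `e ∉ C₁` keeps locality on `insert e S₀`. [folklore] -/
theorem FstLocal.inter_not_mem {S₀ : Finset ι} {Z : Set (Finset ι × Finset ι)}
    (hZ : FstLocal S₀ Z) (e : ι) : FstLocal (insert e S₀) (Z ∩ {x | e ∉ x.1}) := fun x y h hx =>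
  ⟨hZ x y (fun i hi => h i (Finset.mem_insert_of_mem hi)) hx.1,
    fun hy => hx.2 ((h e (Finset.mem_insert_self e S₀)).2 hy)⟩

/-! ### The one-edge splitting step -/

/-- The swap of the single coordinate `e` between the two configurations (of coordinates
`⊆ D`): `(C₁, C₂) ↦ (C₁ →_{D ∖ e} C₂, C₂ →_{D ∖ e} C₁)`. [cite: Gladkov2024, proof of Thm. 4.3] -/
def swapAt (D : Finset ι) (e : ι) : Finset ι × Finset ι → Finset ι × Finset ι :=
  swapPair fun _ : Finset ι => D.erase e

/-- First component of the swap at `e`. [folklore] -/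
theorem mem_swapAt_fst {D : Finset ι} {e : ι} {x : Finset ι × Finset ι} (hx1 : x.1 ⊆ D)
    (hx2 : x.2 ⊆ D) (i : ι) :
    i ∈ (swapAt D e x).1 ↔ (i ≠ e ∧ i ∈ x.1) ∨ (i = e ∧ i ∈ x.2) := by
  simp only [swapAt, swapPair]
  rw [mem_splice]
  simp only [Finset.mem_erase]
  constructor
  · rintro (⟨⟨hie, -⟩, hi⟩ | ⟨hne, hi⟩)
    · exact Or.inl ⟨hie, hi⟩
    · right
      refine ⟨?_, hi⟩
      by_contra hie
      exact hne ⟨hie, hx2 hi⟩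
  · rintro (⟨hie, hi⟩ | ⟨hie, hi⟩)
    · exact Or.inl ⟨⟨hie, hx1 hi⟩, hi⟩
    · right
      exact ⟨fun h => h.1 hie, hi⟩

/-- Second component of the swap at `e`. [folklore] -/
theorem mem_swapAt_snd {D : Finset ι} {e : ι} {x : Finset ι × Finset ι} (hx1 : x.1 ⊆ D)
    (hx2 : x.2 ⊆ D) (i : ι) :
    i ∈ (swapAt D e x).2 ↔ (i ≠ e ∧ i ∈ x.2) ∨ (i = e ∧ i ∈ x.1) := by
  simp only [swapAt, swapPair]
  rw [mem_splice]
  simp only [Finset.mem_erase]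
  constructor
  · rintro (⟨⟨hie, -⟩, hi⟩ | ⟨hne, hi⟩)
    · exact Or.inl ⟨hie, hi⟩
    · right
      refine ⟨?_, hi⟩
      by_contra hie
      exact hne ⟨hie, hx1 hi⟩
  · rintro (⟨hie, hi⟩ | ⟨hie, hi⟩)
    · exact Or.inl ⟨⟨hie, hx2 hi⟩, hi⟩
    · right
      exact ⟨fun h => h.1 hie, hi⟩

/-- Pointwise description of `C₁ →_{S ∪ {e}} C₂`. [folklore] -/
theorem mem_splice_insert {S X₁ X₂ : Finset ι} {e i : ι} :
    i ∈ splice (insert e S) X₁ X₂ ↔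
      (i = e ∧ i ∈ X₁) ∨ (i ≠ e ∧ ((i ∈ S ∧ i ∈ X₁) ∨ (i ∉ S ∧ i ∈ X₂))) := by
  rw [mem_splice]
  simp only [Finset.mem_insert]
  by_cases hie : i = e
  · subst hie; simp
  · simp [hie]

/-- **The combinatorial heart of the splitting step** (proof of Thm. 4.3, p. 6): if
`(C₁, C₂) ∈ A □_{S ∪ {e}} B` but `∉ A □_S B` (`e ∉ S`), then swapping the coordinate `e`
between `C₁` and `C₂` gives a pair in `A □_S B` but not in `A □_{S ∪ {e}} B`.
[cite: Gladkov2024, proof of Thm. 4.3] -/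
theorem swapAt_mem_of_mem_diff {D S : Finset ι} {e : ι} (he : e ∉ S) {A B : Set (Finset ι)}
    {x : Finset ι × Finset ι} (hx1 : x.1 ⊆ D) (hx2 : x.2 ⊆ D)
    (hx : x ∈ dsqWith (insert e S) A B \ dsqWith S A B) :
    swapAt D e x ∈ dsqWith S A B \ dsqWith (insert e S) A B := by
  obtain ⟨⟨I, J, hI, hIA, hJ, hJB, hdisj⟩, hx0⟩ := hx
  have hJ' : ∀ i ∈ J, (i = e ∧ i ∈ x.1) ∨ (i ≠ e ∧ ((i ∈ S ∧ i ∈ x.1) ∨ (i ∉ S ∧ i ∈ x.2))) :=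
    fun i hi => mem_splice_insert.1 (hJ hi)
  have hdisj' : ∀ i ∈ I, i ∈ J → i ∉ S := fun i hiI hiJ hiS =>
    hdisj i hiI hiJ (Finset.mem_insert_of_mem hiS)
  -- `e ∈ J`, hence `e ∉ I`, `e ∈ C₁`
  have heJ : e ∈ J := by
    by_contra heJ
    refine hx0 ⟨I, J, hI, hIA, fun i hi => mem_splice.2 ?_, hJB, hdisj'⟩
    have hie : i ≠ e := fun h => heJ (h ▸ hi)
    rcases hJ' i hi with ⟨h, -⟩ | ⟨-, h⟩
    · exact absurd h hie
    · exact h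
  have heI : e ∉ I := fun heI => hdisj e heI heJ (Finset.mem_insert_self e S)
  have he1 : e ∈ x.1 := by
    rcases hJ' e heJ with ⟨-, h⟩ | ⟨h, -⟩
    · exact h
    · exact absurd rfl h
  -- `e ∉ C₂`
  have he2 : e ∉ x.2 := by
    intro he2
    refine hx0 ⟨I, J, hI, hIA, fun i hi => mem_splice.2 ?_, hJB, hdisj'⟩
    rcases hJ' i hi with ⟨h, -⟩ | ⟨-, h⟩
    · subst h; exact Or.inr ⟨he, he2⟩
    · exact h
  -- the swapped pair `y = (C₁ - e, C₂ + e)`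
  have hy1 : ∀ i, i ∈ (swapAt D e x).1 ↔ (i ≠ e ∧ i ∈ x.1) := fun i => by
    rw [mem_swapAt_fst hx1 hx2]
    constructor
    · rintro (h | ⟨rfl, h⟩)
      · exact h
      · exact absurd h he2
    · exact fun h => Or.inl h
  have hy2 : ∀ i, i ∈ (swapAt D e x).2 ↔ (i ≠ e ∧ i ∈ x.2) ∨ i = e := fun i => by
    rw [mem_swapAt_snd hx1 hx2]
    constructor
    · rintro (h | ⟨h, -⟩)
      · exact Or.inl h
      · exact Or.inr h
    · rintro (h | h)
      · exact Or.inl h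
      · exact Or.inr ⟨h, h ▸ he1⟩
  refine ⟨⟨I, J, fun i hi => (hy1 i).2 ⟨fun h => heI (h ▸ hi), hI hi⟩, hIA,
    fun i hi => mem_splice.2 ?_, hJB, hdisj'⟩, ?_⟩
  · -- `J ⊆ y₁ →_S y₂`
    rw [hy1, hy2]
    rcases hJ' i hi with ⟨h, -⟩ | ⟨hie, ⟨hiS, hiX⟩ | ⟨hiS, hiX⟩⟩
    · subst h; exact Or.inr ⟨he, Or.inr rfl⟩
    · exact Or.inl ⟨hiS, hie, hiX⟩
    · exact Or.inr ⟨hiS, Or.inl ⟨hie, hiX⟩⟩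
  · -- `y ∉ A □_{S ∪ {e}} B`
    rintro ⟨I', J', hI', hI'A, hJ'y, hJ'B, hdisj''⟩
    have heI' : e ∉ I' := fun h => ((hy1 e).1 (hI' h)).1 rfl
    have heJ' : e ∉ J' := fun h => by
      rcases mem_splice_insert.1 (hJ'y h) with ⟨-, h1⟩ | ⟨h1, -⟩
      · exact ((hy1 e).1 h1).1 rfl
      · exact h1 rfl
    refine hx0 ⟨I', J', fun i hi => ((hy1 i).1 (hI' hi)).2, hI'A, fun i hi => mem_splice.2 ?_,
      hJ'B, fun i hiI hiJ hiS => hdisj'' i hiI hiJ (Finset.mem_insert_of_mem hiS)⟩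
    have hie : i ≠ e := fun h => heJ' (h ▸ hi)
    rcases mem_splice_insert.1 (hJ'y hi) with ⟨h, -⟩ | ⟨-, ⟨hiS, hiY⟩ | ⟨hiS, hiY⟩⟩
    · exact absurd h hie
    · exact Or.inl ⟨hiS, ((hy1 i).1 hiY).2⟩
    · rcases (hy2 i).1 hiY with ⟨-, h⟩ | h
      · exact Or.inr ⟨hiS, h⟩
      · exact absurd h hie

/-- **The splitting step** (inequality (6) in the proof of Thm. 4.3, summed): for `e ∉ S` and an
auxiliary event `Z` determined by `C₁` on `S`,
`P(Z ∩ A □_{S ∪ {e}} B) ≤ P(Z ∩ A □_S B)`. [cite: Gladkov2024, proof of Thm. 4.3, (6)] -/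
theorem Pr2_dsqWith_insert_le (D : Finset ι) {p : ℝ} (hp0 : 0 ≤ p) (hp1 : p ≤ 1)
    {S : Finset ι} {e : ι} (he : e ∉ S) (A B : Set (Finset ι)) {Z : Set (Finset ι × Finset ι)}
    (hZ : FstLocal S Z) :
    Pr2 D p (Z ∩ dsqWith (insert e S) A B) ≤ Pr2 D p (Z ∩ dsqWith S A B) := by
  set Dp := dsqWith (insert e S) A B
  set D0 := dsqWith S A B
  rw [Pr2_eq_inter_add_diff D p (Z ∩ Dp) D0, Pr2_eq_inter_add_diff D p (Z ∩ D0) Dp]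
  refine add_le_add (Pr2_mono D hp0 hp1 fun x _ _ hx => ⟨⟨hx.1.1, hx.2⟩, hx.1.2⟩) ?_
  rw [← Pr2_preimage_swapPair D p (selfDetermined_const (D.erase e)) ((Z ∩ D0) \ Dp)]
  refine Pr2_mono D hp0 hp1 fun x hx1 hx2 hx => ?_
  have hsw := swapAt_mem_of_mem_diff (D := D) he hx1 hx2 ⟨hx.1.2, hx.2⟩
  refine ⟨⟨hZ x _ (fun i hi => ?_) hx.1.1, hsw.1⟩, hsw.2⟩
  show i ∈ x.1 ↔ i ∈ (swapAt D e x).1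
  rw [mem_swapAt_fst hx1 hx2]
  have hie : i ≠ e := fun h => he (h ▸ hi)
  simp [hie]

/-! ### Theorem 4.3 -/

/-- Unfolding `treeDsq` at a node: the root query splits the event according to `e ∈ C₁`.
[folklore] -/
theorem treeDsq_node (S₀ : Finset ι) (e : ι) (yes no : DTree ι) (A B : Set (Finset ι)) :
    treeDsq S₀ (.node e yes no) A B =
      (treeDsq (insert e S₀) yes A B ∩ {x | e ∈ x.1}) ∪
        (treeDsq (insert e S₀) no A B ∩ {x | e ∉ x.1}) := by
  ext x
  simp only [treeDsq, Set.mem_setOf_eq, Set.mem_union, Set.mem_inter_iff, revealed]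
  by_cases he : e ∈ x.1
  · simp only [he, if_true, not_true_eq_false, and_false, or_false, and_true]
    rw [Finset.union_insert, Finset.insert_union]
  · simp only [he, if_false, and_false, false_or, not_false_eq_true, and_true]
    rw [Finset.union_insert, Finset.insert_union]

/-- `treeDsq` at a leaf is `dsqWith S₀`. [folklore] -/
theorem treeDsq_leaf (S₀ : Finset ι) (A B : Set (Finset ι)) :
    treeDsq S₀ (.leaf : DTree ι) A B = dsqWith S₀ A B := by
  ext x
  simp only [treeDsq, Set.mem_setOf_eq, revealed, Finset.union_empty]

/-- **The induction step of Theorem 4.3**: pruning one deepest node does not decrease the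
probability of disjoint occurrence (with any pre-shared set `S₀` and any auxiliary event `Z`
determined by `C₁` on `S₀`). [cite: Gladkov2024, proof of Thm. 4.3] -/
theorem Pr2_treeDsq_le_prune (D : Finset ι) {p : ℝ} (hp0 : 0 ≤ p) (hp1 : p ≤ 1)
    (A B : Set (Finset ι)) : ∀ (T : DTree ι) (S₀ : Finset ι) (Z : Set (Finset ι × Finset ι)),
    FstLocal S₀ Z →
      Pr2 D p (Z ∩ treeDsq S₀ T A B) ≤ Pr2 D p (Z ∩ treeDsq S₀ (prune T) A B)
  | .leaf, _, _, _ => le_rfl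
  | .node e yes no, S₀, Z, hZ => by
      have hsplit : ∀ yes' no' : DTree ι, Pr2 D p (Z ∩ treeDsq S₀ (.node e yes' no') A B) =
          Pr2 D p ((Z ∩ {x | e ∈ x.1}) ∩ treeDsq (insert e S₀) yes' A B) +
            Pr2 D p ((Z ∩ {x | e ∉ x.1}) ∩ treeDsq (insert e S₀) no' A B) := by
        intro yes' no'
        rw [treeDsq_node, Set.inter_union_distrib_left, Pr2_union]
        · congr 1
          · congr 1; ext x; simp only [Set.mem_inter_iff, Set.mem_setOf_eq]; tauto
          · congr 1; ext x; simp only [Set.mem_inter_iff, Set.mem_setOf_eq]; tauto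
        · exact Set.disjoint_left.2 fun x hx hx' => hx'.2.2 hx.2.2
      simp only [prune]
      by_cases hy : size yes = 0
      · by_cases hn : size no = 0
        · -- both children are leaves: the splitting step
          simp only [hy, hn, if_true]
          rw [eq_leaf_of_size_eq_zero hy, eq_leaf_of_size_eq_zero hn, treeDsq_leaf]
          have hnode : treeDsq S₀ (.node e .leaf .leaf) A B = dsqWith (insert e S₀) A B := by
            ext x
            simp only [treeDsq, Set.mem_setOf_eq, revealed, ite_self]
            rw [Finset.union_insert, Finset.union_empty]
          rw [hnode]
          by_cases he : e ∈ S₀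
          · rw [Finset.insert_eq_of_mem he]
          · exact Pr2_dsqWith_insert_le D hp0 hp1 he A B hZ
        · simp only [hy, hn, if_true, if_false]
          rw [hsplit, hsplit]
          exact add_le_add le_rfl
            (Pr2_treeDsq_le_prune D hp0 hp1 A B no _ _ (hZ.inter_not_mem e))
      · simp only [hy, if_false]
        rw [hsplit, hsplit]
        exact add_le_add (Pr2_treeDsq_le_prune D hp0 hp1 A B yes _ _ (hZ.inter_mem e)) le_rfl

/-- Iterating the pruning down to the empty tree. [cite: Gladkov2024, proof of Thm. 4.3] -/
theorem Pr2_treeDsq_le_dsqWith (D : Finset ι) {p : ℝ} (hp0 : 0 ≤ p) (hp1 : p ≤ 1)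
    (A B : Set (Finset ι)) : ∀ (n : ℕ) (T : DTree ι), size T = n →
      Pr2 D p (treeDsq ∅ T A B) ≤ Pr2 D p (dsqWith ∅ A B)
  | 0, T, hT => by rw [eq_leaf_of_size_eq_zero hT, treeDsq_leaf]
  | n + 1, T, hT => by
      have hne : size T ≠ 0 := by omega
      have hsz : size (prune T) = n := by have := size_prune T hne; omega
      calc Pr2 D p (treeDsq ∅ T A B) = Pr2 D p (Set.univ ∩ treeDsq ∅ T A B) := by
            rw [Set.univ_inter]
        _ ≤ Pr2 D p (Set.univ ∩ treeDsq ∅ (prune T) A B) :=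
            Pr2_treeDsq_le_prune D hp0 hp1 A B T ∅ Set.univ (fstLocal_univ ∅)
        _ = Pr2 D p (treeDsq ∅ (prune T) A B) := by rw [Set.univ_inter]
        _ ≤ Pr2 D p (dsqWith ∅ A B) := Pr2_treeDsq_le_dsqWith D hp0 hp1 A B n (prune T) hsz

/-- **Gladkov 2024, Theorem 4.3 (decision-tree van den Berg–Kesten inequality)**, finitary
form: for increasing events `A, B` of configurations and the set `S(C₁)` built by any decision
tree `T`, `P(A □_S B) ≤ P(A) P(B)`. For the tree querying everything this is the classical BK
inequality; for the empty tree it is the independence of `C₁` and `C₂`.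
[cite: Gladkov2024, Thm. 4.3] -/
theorem Pr2_treeDsq_le (D : Finset ι) {p : ℝ} (hp0 : 0 ≤ p) (hp1 : p ≤ 1) (T : DTree ι)
    {A B : Set (Finset ι)} (hA : IsUpperSet A) (hB : IsUpperSet B) :
    Pr2 D p (treeDsq ∅ T A B) ≤ Pr D p A * Pr D p B := by
  rw [← Pr2_prod]
  exact (Pr2_treeDsq_le_dsqWith D hp0 hp1 A B (size T) T rfl).trans
    (Pr2_mono D hp0 hp1 fun x _ _ hx => dsqWith_empty_subset hA hB hx)

end DecisionTree

end Literature.Probability.Percolation
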